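import Summits.RiemannHypothesis.RiemannHypothesis.Theorems.AsymptoticCriticalLine.Negative.BandForms
import Literature.NumberTheory.LFunctions.ExplicitFormulaPsiOneTrivialZeros

/-!
# Two more forms of `AsymptoticCriticalLine`: Faure–Tsujii's literal shape, and the limit form (negative-side forms, cycle 3)

* `ftShape_iff_acl`: the crux's informal text calls it "verbatim the shape of Faure–Tsujii's
  Theorem 1.2 transported by the dictionary". That theorem allows, besides the first band
  `{|Re z| < τ}`, everything in the deep region `{Re z < −χ₀ + τ}` (lower bands). Transported by
  `Re z ↔ Re s − 1/2` WITHOUT any strip restriction — finitely many zeros of `ζ` with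
  `Re s ≥ 1/2 − χ₀ + τ` and `|Re s − 1/2| ≥ τ` — the statement is equivalent to the crux for EVERY
  gap parameter `χ₀ ≥ 0`: the only zeros of `ζ` left of the strip are the trivial ones on the real
  axis (tree `riemannZeta_eq_zero_iff_of_re_nonpos`), finitely many above any depth, and the right
  half alone is the crux (`acl_iff_rightBand`). So the transport loses nothing and gains nothing,
  whatever `χ₀` the dictionary produces; and `ζ` has no populated "lower band" at all (a
  disanalogy with the Anosov picture, where every band obeys a Weyl law).
* `acl_iff_tendsto`: the crux ⟺ `|Re ρ − 1/2| → 0` along the cofinite filter of the non-trivial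
  zeros ("`Θ_ess = 1/2`" as a limit statement).
-/

noncomputable section

namespace Summit.RiemannHypothesis.RiemannHypothesis.Theorems.AsymptoticCriticalLine.Negative

open Complex Set
open Summit.RiemannHypothesis.RiemannHypothesis.Theses.RuelleBand (AsymptoticCriticalLine)

/-- FAURE–TSUJII'S LITERAL SHAPE with gap `χ₀`, transported (`Re z ↔ Re s − 1/2`), no strip
restriction: for every `τ > 0` only finitely many zeros of `ζ` have `Re s ≥ 1/2 − χ₀ + τ` and
`|Re s − 1/2| ≥ τ`. [cite: FaureTsujii2016, Thm 1.2] [folklore] -/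
def FTShape (χ₀ : ℝ) : Prop :=
  ∀ τ : ℝ, 0 < τ → {s : ℂ | riemannZeta s = 0 ∧ 1 / 2 - χ₀ + τ ≤ s.re ∧ τ ≤ |s.re - 1 / 2|}.Finite

/-- The transported Faure–Tsujii shape is the crux, for every `χ₀ ≥ 0`. [folklore] -/
theorem ftShape_iff_acl {χ₀ : ℝ} (hχ₀ : 0 ≤ χ₀) : FTShape χ₀ ↔ AsymptoticCriticalLine := by
  constructor
  · intro h
    rw [acl_iff_rightBand]
    intro ε hε
    refine (h ε hε).subset ?_
    rintro s ⟨hz, hre, h1⟩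
    exact ⟨hz, by linarith, by rw [abs_of_pos (by linarith)]; linarith⟩
  · intro hacl τ hτ
    have hfin : (bandSet riemannZeta τ).Finite := acl_iff_bandSet.1 hacl τ hτ
    obtain ⟨N, hN⟩ := exists_nat_gt (χ₀ / 2)
    refine (hfin.union (Set.finite_range (fun k : Fin N => (-2 * (((k : ℕ) : ℂ) + 1))))).subset ?_
    rintro s ⟨hz, hre, hτs⟩
    rcases lt_or_ge 0 s.re with h0 | h0
    · left
      have h1 : s.re < 1 := by
        by_contra h1
        exact riemannZeta_ne_zero_of_one_le_re (not_lt.1 h1) hz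
      exact ⟨hz, h0, h1, hτs⟩
    · right
      obtain ⟨n, rfl⟩ :=
        (Literature.NumberTheory.LFunctions.riemannZeta_eq_zero_iff_of_re_nonpos h0).1 hz
      rw [trivialZero_re] at hre
      have hn : n < N := by
        have : (n : ℝ) + 1 < N := by linarith
        exact_mod_cast (by linarith : (n : ℝ) < N)
      exact ⟨⟨n, hn⟩, rfl⟩

/-- LIMIT FORM: the crux ⟺ `|Re ρ − 1/2| → 0` along the cofinite filter of the non-trivial zeros
of `ζ`. [folklore] -/
theorem acl_iff_tendsto :
    AsymptoticCriticalLine ↔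
      Filter.Tendsto (fun ρ : {s : ℂ // riemannZeta s = 0 ∧ 0 < s.re ∧ s.re < 1} => |ρ.1.re - 1 / 2|)
        Filter.cofinite (nhds 0) := by
  rw [acl_iff_bandSet, Metric.tendsto_nhds]
  refine forall₂_congr fun ε _ => ?_
  rw [Filter.eventually_cofinite]
  have hset : {ρ : {s : ℂ // riemannZeta s = 0 ∧ 0 < s.re ∧ s.re < 1} | ¬ dist |ρ.1.re - 1 / 2| 0 < ε}
      = Subtype.val ⁻¹' bandSet riemannZeta ε := by
    ext ρ
    simp only [mem_setOf_eq, mem_preimage, bandSet, Real.dist_eq, sub_zero, abs_abs, not_lt]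
    exact ⟨fun h => ⟨ρ.2.1, ρ.2.2.1, ρ.2.2.2, h⟩, fun h => h.2.2.2⟩
  rw [hset]
  constructor
  · intro h
    exact h.preimage Subtype.val_injective.injOn
  · intro h
    have heq : bandSet riemannZeta ε =
        Subtype.val '' (Subtype.val ⁻¹' bandSet riemannZeta ε :
          Set {s : ℂ // riemannZeta s = 0 ∧ 0 < s.re ∧ s.re < 1}) := by
      ext s
      constructor
      · intro hs
        exact ⟨⟨s, hs.1, hs.2.1, hs.2.2.1⟩, hs, rfl⟩
      · rintro ⟨ρ, hρ, rfl⟩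
        exact hρ
    rw [heq]
    exact h.image _

end Summit.RiemannHypothesis.RiemannHypothesis.Theorems.AsymptoticCriticalLine.Negative
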